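import Mathlib.Analysis.Calculus.Monotone
import Mathlib.MeasureTheory.Measure.Lebesgue.Basic
import Literature.MathematicalPhysics.QuantumLattice.HubbardGrandCanonicalDensity
import HarnessLib

/-!
# The grand-canonical density of the 2D Hubbard torus: a two-point bracket gives a convergent density in between

Family `hubbard` / topic `MathematicalPhysics/QuantumLattice`; continuation of `HubbardGrandCanonicalDensity.lean`
(Griffiths' lemma `tendsto_gcDensity_of_hasDerivAt` and the jump-free-window form
`exists_tendsto_gcDensity_of_regularWindow`, which ASSUMES the limiting equation of state differentiable on a whole
interval).  Written for the density conjunct of crux `CapRgSymmetricCertificatePinned` (route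
`HubbardSuperconductivity/AposterioriCapRg`, item stmt-HubbardSuperconductivity-14045, line
`strict-continuum-certificate-transfer` v4), whose doping `δ` is only constrained to a window, so that NO regularity of the
equation of state is needed:

* `exists_differentiableAt_of_monotone` / `_of_antitone`: a monotone (antitone) function `ℝ → ℝ` is differentiable at
  SOME point of every non-trivial open interval — Lebesgue's theorem (Mathlib `Monotone.ae_differentiableAt`) and the
  positivity of the length of the interval;
* `antitone_of_tendsto_gcEnergyDensity`: any pointwise thermodynamic limit `g(μ)` of
  `E₀(hubbardTorusWith 2 (L+1) t U μ)/(L+1)²` is antitone (the finite-volume bound `0 ≤ E(μ) - E(μ')` for `μ ≤ μ'`,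
  `groundEnergy_torus_sub_mem_Icc_of_le`, passed to the limit);
* `exists_tendsto_gcDensity_of_bracket`: IF such a limit `g` exists at every `μ` (for `t = 1` this is the Theorems-side
  `stub_torusGcEnergyDensityLimit` of route WeakCouplingBCS — not importable here), and at two chemical potentials
  `μ₁ < μ₂` the tracial ground-state densities satisfy `lo ≤ n_{L+1}(μ₁)` and `n_{L+1}(μ₂) ≤ hi`, each only FREQUENTLY in
  `L`, THEN some `μ ∈ (μ₁, μ₂)` has a CONVERGENT density, `n_{L+1}(μ) → d`, with `d = -g'(μ) ∈ [lo, hi]`: take a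
  differentiability point `μ` of the antitone `g` in `(μ₁, μ₂)`, apply Griffiths' lemma there, and transport the two
  one-sided bounds by the monotonicity of the finite-volume density in `μ` (`gcNumber_torus_mono`) — a closed half-line met
  frequently along a convergent sequence contains the limit.

Everything is proved; no definition and no named fact is introduced. [folklore]

## Sources

R. B. Griffiths, J. Math. Phys. 5 (1964) 1215 (Griffiths' lemma); D. Ruelle, *Statistical Mechanics: Rigorous Results*
(1969), §3.4 (density versus chemical potential, concavity); H. Lebesgue's differentiation theorem for monotone functions
(Mathlib `Mathlib.Analysis.Calculus.Monotone`).
-/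

noncomputable section

namespace Literature.MathematicalPhysics.QuantumLattice

open Matrix Filter MeasureTheory
open _root_.Topology

/-! ### Monotone functions have differentiability points in every open interval -/

/-- **A monotone real function is differentiable at some point of every non-trivial open interval** (it is
differentiable Lebesgue-a.e., and `(a, b)` has positive length). [folklore] -/
theorem exists_differentiableAt_of_monotone {g : ℝ → ℝ} (hg : Monotone g) {a b : ℝ} (hab : a < b) :
    ∃ x ∈ Set.Ioo a b, DifferentiableAt ℝ g x := by
  have h2 : ∀ᵐ x ∂(volume.restrict (Set.Ioo a b)), x ∈ Set.Ioo a b ∧ DifferentiableAt ℝ g x :=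
    (ae_restrict_mem measurableSet_Ioo).and (ae_restrict_of_ae hg.ae_differentiableAt)
  have hne : volume.restrict (Set.Ioo a b) ≠ 0 := by
    rw [Ne, Measure.restrict_eq_zero, Real.volume_Ioo, ENNReal.ofReal_eq_zero, not_le]
    exact sub_pos.2 hab
  haveI := ae_neBot.2 hne
  obtain ⟨x, hx, hdx⟩ := h2.exists
  exact ⟨x, hx, hdx⟩

/-- **An antitone real function is differentiable at some point of every non-trivial open interval.** [folklore] -/
theorem exists_differentiableAt_of_antitone {g : ℝ → ℝ} (hg : Antitone g) {a b : ℝ} (hab : a < b) :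
    ∃ x ∈ Set.Ioo a b, DifferentiableAt ℝ g x := by
  obtain ⟨x, hx, hd⟩ := exists_differentiableAt_of_monotone hg.neg hab
  exact ⟨x, hx, by simpa using hd.neg⟩

/-! ### The torus: antitone limits and the bracket form of the density clause -/

/-- **Any thermodynamic limit of the grand-canonical ground-state energy density of the torus is antitone in `μ`**
(`0 ≤ E₀(K_μ) - E₀(K_{μ'})` for `μ ≤ μ'` at every volume). [folklore] -/
theorem antitone_of_tendsto_gcEnergyDensity (t U : ℝ) {g : ℝ → ℝ}
    (hg : ∀ μ : ℝ, Tendsto (fun L : ℕ =>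
      (hubbardTorusWith 2 (L + 1) t U μ).groundEnergy / ((L + 1 : ℕ) : ℝ) ^ 2) atTop (𝓝 (g μ))) :
    Antitone g := by
  intro μ ν h
  refine le_of_tendsto_of_tendsto (hg ν) (hg μ) (Eventually.of_forall fun L => ?_)
  exact div_le_div_of_nonneg_right
    (sub_nonneg.1 (groundEnergy_torus_sub_mem_Icc_of_le (L + 1) t U h).1) (by positivity)

/-- **The bracket form of the density clause.** Fix `t, U` and suppose the grand-canonical ground-state energy density
`E₀(hubbardTorusWith 2 (L+1) t U μ)/(L+1)²` has a thermodynamic limit `g(μ)` for every `μ`.  If at two chemical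
potentials `μ₁ < μ₂` the tracial ground-state densities `n_{L+1}(μ) = Re ω_{L+1,μ}(N)/(L+1)²` satisfy `lo ≤ n_{L+1}(μ₁)` and
`n_{L+1}(μ₂) ≤ hi`, each frequently in `L`, then for SOME `μ ∈ (μ₁, μ₂)` the density converges, `n_{L+1}(μ) → d`, with
`g` differentiable at `μ`, `g'(μ) = -d` and `d ∈ [lo, hi]` (a differentiability point of the antitone `g`, Griffiths'
lemma, and monotone transport of the two one-sided bounds).  No regularity of `g` is assumed. [folklore] -/
theorem exists_tendsto_gcDensity_of_bracket (t U : ℝ) {g : ℝ → ℝ}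
    (hg : ∀ μ : ℝ, Tendsto (fun L : ℕ =>
      (hubbardTorusWith 2 (L + 1) t U μ).groundEnergy / ((L + 1 : ℕ) : ℝ) ^ 2) atTop (𝓝 (g μ)))
    {μ₁ μ₂ lo hi : ℝ} (h12 : μ₁ < μ₂)
    (hlo : ∃ᶠ L : ℕ in atTop, lo ≤
      ((hubbardTorusWith 2 (L + 1) t U μ₁).groundStateFunctional totalNumber).re / ((L + 1 : ℕ) : ℝ) ^ 2)
    (hhi : ∃ᶠ L : ℕ in atTop,
      ((hubbardTorusWith 2 (L + 1) t U μ₂).groundStateFunctional totalNumber).re / ((L + 1 : ℕ) : ℝ) ^ 2 ≤ hi) :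
    ∃ μ ∈ Set.Ioo μ₁ μ₂, ∃ d ∈ Set.Icc lo hi, HasDerivAt g (-d) μ ∧
      Tendsto (fun L : ℕ => ((hubbardTorusWith 2 (L + 1) t U μ).groundStateFunctional totalNumber).re /
        ((L + 1 : ℕ) : ℝ) ^ 2) atTop (𝓝 d) := by
  obtain ⟨μ, hμ, hdiff⟩ := exists_differentiableAt_of_antitone (antitone_of_tendsto_gcEnergyDensity t U hg) h12
  have hlim := tendsto_gcDensity_of_hasDerivAt t U μ (Eventually.of_forall hg) hdiff.hasDerivAt
  refine ⟨μ, hμ, -deriv g μ, ⟨?_, ?_⟩, by simpa using hdiff.hasDerivAt, hlim⟩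
  · refine isClosed_Ici.mem_of_frequently_of_tendsto (hlo.mono fun L hL => ?_) hlim
    exact hL.trans (div_le_div_of_nonneg_right (gcNumber_torus_mono (L + 1) t U hμ.1.le) (by positivity))
  · refine isClosed_Iic.mem_of_frequently_of_tendsto (hhi.mono fun L hL => ?_) hlim
    exact (div_le_div_of_nonneg_right (gcNumber_torus_mono (L + 1) t U hμ.2.le) (by positivity)).trans hL

end Literature.MathematicalPhysics.QuantumLattice

end
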